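import Summits.CriticalPhenomena.CardyFormulaZ2.Theorems.CardyFlipRussoVoronoiHubFromSmirnovDefs

/-!
# Stub `insensitivity_unionLaw` of line `moebius-exact-delaunay-dilation-ward`
# (crux `VoronoiHubFromSmirnov`, stmt-CriticalPhenomena-6433)

The Insensitivity Lemma of Benjamini–Schramm (I. Benjamini, O. Schramm, *Conformal invariance of
Voronoi percolation*, Comm. Math. Phys. 197 (1998) 75–107, Lemma 8.1), in its finite form.

On the subsets of a finite type `X` with `n = |X|` elements let `η` be the `p`-Bernoulli product
law, `η(a) = p^|a| (1-p)^(n-|a|)` (`0 < p < 1`), and let `ν` be any probability law.  The law of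
`ω ∪ Z` with `ω ∼ η` and `Z ∼ ν` independent is `(η ∪ ν)(a) = Σ_{b ∪ c = a} η(b) ν(c)`, and

`Σ_a |(η ∪ ν)(a) − η(a)| ≤ √( Σ_{b,c} ν(b) ν(c) p^{-|b ∩ c|} − 1 )`.

Proof ("What can one say? Cauchy–Schwarz!", loc. cit. p. 96).
* The interval sums of `η`: for `l ⊆ u`, `Σ_{l ⊆ b ⊆ u} η(b) = p^|l| (1-p)^(n-|u|)` (binomial
  theorem on `(u \ l).powerset`, `Finset.sum_pow_mul_eq_add_pow`).  In particular
  `Σ_{a ⊇ d} η(a) = p^|d|`, `Σ_a η(a) = 1`, and, since `b ∪ c = a ↔ a \ c ⊆ b ⊆ a` for `c ⊆ a`,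
  `Σ_{b : b ∪ c = a} η(b) = η(a) p^{-|c|}`; hence `(η ∪ ν)(a) = η(a) f(a)` with
  `f(a) = Σ_{c ⊆ a} ν(c) p^{-|c|}`.
* Cauchy–Schwarz with the weights `η`: `(Σ_a η(a) |f(a) − 1|)² ≤ Σ_a η(a) (f(a) − 1)²
  = Σ η f² − 2 Σ η f + 1`, where `Σ_a η(a) f(a) = Σ_c ν(c) p^{-|c|} p^{|c|} = 1` and
  `Σ_a η(a) f(a)² = Σ_{b,c} ν(b) ν(c) p^{-|b|-|c|} p^{|b ∪ c|} = Σ_{b,c} ν(b) ν(c) p^{-|b ∩ c|}`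
  (`|b ∪ c| + |b ∩ c| = |b| + |c|`).

No new definitions; Mathlib only.
-/

noncomputable section

namespace Summit.CriticalPhenomena.CardyFormulaZ2.Cruxes.VoronoiHubFromSmirnov.MoebiusExactDelaunayDilationWard

open Finset

variable {X : Type} [Fintype X] [DecidableEq X]

/-- Interval sums of the Bernoulli product weights: for `l ⊆ u`,
`Σ_{l ⊆ b ⊆ u} p^|b| (1-p)^(n-|b|) = p^|l| (1-p)^(n-|u|)` (binomial theorem on `u \ l`). -/
theorem ins_interval_sum (p : ℝ) {l u : Finset X} (hlu : l ⊆ u) :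
    ∑ b : Finset X,
        (if l ⊆ b ∧ b ⊆ u then p ^ b.card * (1 - p) ^ (Fintype.card X - b.card) else 0)
      = p ^ l.card * (1 - p) ^ (Fintype.card X - u.card) := by
  rw [← Finset.sum_filter]
  have hul : (u \ l).card = u.card - l.card := Finset.card_sdiff_of_subset hlu
  have hlu' : l.card ≤ u.card := Finset.card_le_card hlu
  have hun : u.card ≤ Fintype.card X := Finset.card_le_univ u
  calc ∑ b ∈ Finset.univ.filter (fun b => l ⊆ b ∧ b ⊆ u),
          p ^ b.card * (1 - p) ^ (Fintype.card X - b.card)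
      = ∑ s ∈ (u \ l).powerset, p ^ (l ∪ s).card * (1 - p) ^ (Fintype.card X - (l ∪ s).card) := by
        refine Finset.sum_nbij' (fun b => b \ l) (fun s => l ∪ s) ?_ ?_ ?_ ?_ ?_
        · intro b hb
          simp only [Finset.mem_filter, Finset.mem_univ, true_and] at hb
          exact Finset.mem_powerset.mpr (Finset.sdiff_subset_sdiff hb.2 (Finset.Subset.refl l))
        · intro s hs
          rw [Finset.mem_powerset] at hs
          simp only [Finset.mem_filter, Finset.mem_univ, true_and]
          exact ⟨Finset.subset_union_left, Finset.union_subset hlu (hs.trans Finset.sdiff_subset)⟩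
        · intro b hb
          simp only [Finset.mem_filter, Finset.mem_univ, true_and] at hb
          exact Finset.union_sdiff_of_subset hb.1
        · intro s hs
          rw [Finset.mem_powerset] at hs
          exact Finset.union_sdiff_cancel_left (Finset.disjoint_sdiff.mono_right hs)
        · intro b hb
          simp only [Finset.mem_filter, Finset.mem_univ, true_and] at hb
          simp only [Finset.union_sdiff_of_subset hb.1]
    _ = ∑ s ∈ (u \ l).powerset, p ^ l.card * (1 - p) ^ (Fintype.card X - u.card)
          * (p ^ s.card * (1 - p) ^ ((u \ l).card - s.card)) := by
        refine Finset.sum_congr rfl fun s hs => ?_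
        rw [Finset.mem_powerset] at hs
        have hsc : s.card ≤ u.card - l.card := hul ▸ Finset.card_le_card hs
        have hdisj : Disjoint l s := Finset.disjoint_sdiff.mono_right hs
        rw [Finset.card_union_of_disjoint hdisj, hul,
          show Fintype.card X - (l.card + s.card)
              = (Fintype.card X - u.card) + (u.card - l.card - s.card) by omega,
          pow_add, pow_add]
        ring
    _ = p ^ l.card * (1 - p) ^ (Fintype.card X - u.card) := by
        rw [← Finset.mul_sum, Finset.sum_pow_mul_eq_add_pow,
          show p + (1 - p) = (1 : ℝ) by ring, one_pow, mul_one]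

/-- Upper sums of the Bernoulli product weights: `Σ_{a ⊇ d} p^|a| (1-p)^(n-|a|) = p^|d|`. -/
theorem ins_sum_supset (p : ℝ) (d : Finset X) :
    ∑ a : Finset X, (if d ⊆ a then p ^ a.card * (1 - p) ^ (Fintype.card X - a.card) else 0)
      = p ^ d.card := by
  have h := ins_interval_sum p (Finset.subset_univ d)
  rw [Finset.card_univ, Nat.sub_self, pow_zero, mul_one] at h
  refine Eq.trans (Finset.sum_congr rfl fun a _ => ?_) h
  simp only [Finset.subset_univ, and_true]

/-- The Bernoulli product weights sum to one: `Σ_a p^|a| (1-p)^(n-|a|) = 1`. -/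
theorem ins_sum_eta (p : ℝ) :
    ∑ a : Finset X, p ^ a.card * (1 - p) ^ (Fintype.card X - a.card) = 1 := by
  have h := ins_sum_supset p (∅ : Finset X)
  rw [Finset.card_empty, pow_zero] at h
  refine Eq.trans (Finset.sum_congr rfl fun a _ => ?_) h
  rw [if_pos (Finset.empty_subset a)]

omit [Fintype X] in
/-- For `c ⊆ a`, `b ∪ c = a ↔ a \ c ⊆ b ⊆ a`. -/
theorem ins_union_eq_iff {a c : Finset X} (hca : c ⊆ a) (b : Finset X) :
    b ∪ c = a ↔ a \ c ⊆ b ∧ b ⊆ a := by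
  constructor
  · rintro rfl
    refine ⟨fun x hx => ?_, Finset.subset_union_left⟩
    rw [Finset.mem_sdiff, Finset.mem_union] at hx
    exact hx.1.resolve_right hx.2
  · rintro ⟨h1, h2⟩
    refine Finset.Subset.antisymm (Finset.union_subset h2 hca) fun x hx => ?_
    rw [Finset.mem_union]
    by_cases hxc : x ∈ c
    · exact Or.inr hxc
    · exact Or.inl (h1 (Finset.mem_sdiff.mpr ⟨hx, hxc⟩))

/-- The `η`-mass of `{b | b ∪ c = a}`: it is `η(a) p^{-|c|}` if `c ⊆ a` and `0` otherwise. -/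
theorem ins_sum_union_eq (p : ℝ) (hp : p ≠ 0) (a c : Finset X) :
    ∑ b : Finset X, (if b ∪ c = a then p ^ b.card * (1 - p) ^ (Fintype.card X - b.card) else 0)
      = if c ⊆ a then p ^ a.card * (1 - p) ^ (Fintype.card X - a.card) * p⁻¹ ^ c.card else 0 := by
  by_cases hca : c ⊆ a
  · rw [if_pos hca]
    simp only [ins_union_eq_iff hca]
    rw [ins_interval_sum p Finset.sdiff_subset, Finset.card_sdiff_of_subset hca,
      pow_sub₀ _ hp (Finset.card_le_card hca), inv_pow]
    ring
  · rw [if_neg hca]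
    refine Finset.sum_eq_zero fun b _ => ?_
    rw [if_neg]
    rintro rfl
    exact hca Finset.subset_union_right

/-- The Insensitivity Lemma with the Bernoulli weights abstracted as `η`. -/
theorem ins_main (p : ℝ) (hp0 : 0 < p) (hp1 : p < 1) (ν : Finset X → ℝ) (hν1 : ∑ b, ν b = 1)
    (η : Finset X → ℝ) (hη : ∀ a, η a = p ^ a.card * (1 - p) ^ (Fintype.card X - a.card)) :
    ∑ a, |(∑ b, ∑ c, if b ∪ c = a then η b * ν c else 0) - η a|
      ≤ Real.sqrt ((∑ b, ∑ c, ν b * ν c * p⁻¹ ^ (b ∩ c).card) - 1) := by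
  have hp0' : p ≠ 0 := hp0.ne'
  have E0 : ∀ a, 0 ≤ η a := fun a => by
    rw [hη]
    exact mul_nonneg (pow_nonneg hp0.le _) (pow_nonneg (sub_nonneg.mpr hp1.le) _)
  have E1 : ∀ d : Finset X, ∑ a, (if d ⊆ a then η a else 0) = p ^ d.card := fun d => by
    simp only [hη]
    exact ins_sum_supset p d
  have E2 : ∑ a, η a = 1 := by
    simp only [hη]
    exact ins_sum_eta p
  have E3 : ∀ a c : Finset X,
      ∑ b, (if b ∪ c = a then η b else 0) = if c ⊆ a then η a * p⁻¹ ^ c.card else 0 :=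
    fun a c => by
    simp only [hη]
    exact ins_sum_union_eq p hp0' a c
  set q := p⁻¹ with hq
  obtain ⟨f, hf⟩ : ∃ f : Finset X → ℝ, ∀ a, f a = ∑ c, (if c ⊆ a then ν c * q ^ c.card else 0) :=
    ⟨_, fun _ => rfl⟩
  -- (η ∪ ν)(a) = η(a) f(a)
  have M1 : ∀ a, (∑ b, ∑ c, if b ∪ c = a then η b * ν c else 0) = η a * f a := by
    intro a
    rw [Finset.sum_comm, hf, Finset.mul_sum]
    refine Finset.sum_congr rfl fun c _ => ?_
    have h1 : (∑ b, if b ∪ c = a then η b * ν c else 0)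
        = (∑ b, if b ∪ c = a then η b else 0) * ν c := by
      rw [Finset.sum_mul]
      refine Finset.sum_congr rfl fun b _ => ?_
      split_ifs <;> simp
    rw [h1, E3]
    split_ifs <;> ring
  have M2 : ∀ a, |η a * f a - η a| = η a * |f a - 1| := by
    intro a
    rw [← mul_sub_one, abs_mul, abs_of_nonneg (E0 a)]
  -- Σ η f = 1
  have M3 : ∑ a, η a * f a = 1 := by
    have h1 : ∀ a, η a * f a = ∑ c, (if c ⊆ a then η a else 0) * (ν c * q ^ c.card) := by
      intro a
      rw [hf, Finset.mul_sum]
      refine Finset.sum_congr rfl fun c _ => ?_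
      split_ifs <;> ring
    simp only [h1]
    rw [Finset.sum_comm]
    refine Eq.trans (Finset.sum_congr rfl fun c _ => ?_) hν1
    rw [← Finset.sum_mul, E1, hq, inv_pow, mul_left_comm, mul_inv_cancel₀ (pow_ne_zero _ hp0'),
      mul_one]
  -- Σ η f² = Σ ν ν p^{-|b ∩ c|}
  have M4 : ∑ a, η a * f a ^ 2 = ∑ b, ∑ c, ν b * ν c * q ^ (b ∩ c).card := by
    have h1 : ∀ a, η a * f a ^ 2 = ∑ b, ∑ c,
        (if b ∪ c ⊆ a then η a else 0) * (ν b * q ^ b.card * (ν c * q ^ c.card)) := by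
      intro a
      rw [sq, hf, Finset.sum_mul_sum, Finset.mul_sum]
      refine Finset.sum_congr rfl fun b _ => ?_
      rw [Finset.mul_sum]
      refine Finset.sum_congr rfl fun c _ => ?_
      by_cases hb : b ⊆ a
      · by_cases hc : c ⊆ a
        · rw [if_pos hb, if_pos hc, if_pos (Finset.union_subset hb hc)]
        · rw [if_neg hc, if_neg (fun h => hc (Finset.subset_union_right.trans h))]
          ring
      · rw [if_neg hb, if_neg (fun h => hb (Finset.subset_union_left.trans h))]
        ring
    simp only [h1]
    rw [Finset.sum_comm]
    refine Finset.sum_congr rfl fun b _ => ?_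
    rw [Finset.sum_comm]
    refine Finset.sum_congr rfl fun c _ => ?_
    rw [← Finset.sum_mul, E1]
    have hbc : q ^ b.card * q ^ c.card = q ^ (b ∪ c).card * q ^ (b ∩ c).card := by
      rw [← pow_add, ← pow_add, Finset.card_union_add_card_inter]
    have hpq : p ^ (b ∪ c).card * q ^ (b ∪ c).card = 1 := by
      rw [← mul_pow, hq, mul_inv_cancel₀ hp0', one_pow]
    linear_combination (ν b * ν c * p ^ (b ∪ c).card) * hbc + (ν b * ν c * q ^ (b ∩ c).card) * hpq
  -- Σ η (f-1)² = Σ ν ν p^{-|b ∩ c|} - 1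
  have M5 : ∑ a, η a * (f a - 1) ^ 2 = (∑ b, ∑ c, ν b * ν c * q ^ (b ∩ c).card) - 1 := by
    have h1 : ∀ a, η a * (f a - 1) ^ 2 = η a * f a ^ 2 - 2 * (η a * f a) + η a := by
      intro a
      ring
    have h2 : ∑ a, 2 * (η a * f a) = 2 := by
      rw [← Finset.mul_sum, M3, mul_one]
    simp only [h1]
    rw [Finset.sum_add_distrib, Finset.sum_sub_distrib, h2, M4, E2]
    ring
  -- Cauchy–Schwarz with the weights η
  have M6 : (∑ a, η a * |f a - 1|) ^ 2 ≤ (∑ a, η a) * ∑ a, η a * (f a - 1) ^ 2 :=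
    Finset.sum_sq_le_sum_mul_sum_of_sq_le_mul _ (fun a _ => E0 a)
      (fun a _ => mul_nonneg (E0 a) (sq_nonneg _))
      (fun a _ => by rw [mul_pow, sq_abs]; exact le_of_eq (by ring))
  rw [E2, one_mul, M5] at M6
  simp only [M1, M2]
  have hL : 0 ≤ ∑ a, η a * |f a - 1| :=
    Finset.sum_nonneg fun a _ => mul_nonneg (E0 a) (abs_nonneg _)
  exact (abs_of_nonneg hL).symm.trans_le (Real.abs_le_sqrt M6)

/-- **Insensitivity Lemma** (Benjamini–Schramm 1998, Lemma 8.1), finite form: for the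
`p`-Bernoulli product law `η` on the subsets of a finite type and any probability law `ν`, the
`ℓ¹` distance between the law of `ω ∪ Z` (`ω ∼ η`, `Z ∼ ν` independent) and `η` is at most
`√(E_{ν ⊗ ν} p^{-|b ∩ c|} − 1)`. -/
theorem insensitivity_unionLaw : ∀ {X : Type} [Fintype X] [DecidableEq X] (p : ℝ), 0 < p → p < 1 → ∀ ν : Finset X → ℝ, (∀ b, 0 ≤ ν b) → ∑ b, ν b = 1 → ∑ a : Finset X, |(∑ b : Finset X, ∑ c : Finset X, if b ∪ c = a then p ^ b.card * (1 - p) ^ (Fintype.card X - b.card) * ν c else 0) - p ^ a.card * (1 - p) ^ (Fintype.card X - a.card)| ≤ Real.sqrt ((∑ b : Finset X, ∑ c : Finset X, ν b * ν c * p⁻¹ ^ (b ∩ c).card) - 1) := by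
  intro X _ _ p hp0 hp1 ν _ hν1
  exact ins_main p hp0 hp1 ν hν1 (fun a => p ^ a.card * (1 - p) ^ (Fintype.card X - a.card))
    fun _ => rfl

end Summit.CriticalPhenomena.CardyFormulaZ2.Cruxes.VoronoiHubFromSmirnov.MoebiusExactDelaunayDilationWard

end
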